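import Summits.Parity.GeneralizedHardyLittlewood.Theses.LeeYangFibres

/-!
# Sketch (crux-ideate round 2, ideator 4) — crux stmt-Parity-14112 `LeeYangFibres.PrimeCellsRelative`
# Card `sieve-out-to-chowla`: under `CellParityLaw` the |S| ≥ 2 Walsh amplitudes ARE rough-restricted
# Liouville correlations, and a dimension-`t` fundamental lemma at level `N^{s/u}` transposes them into
# plain `k`-point Chowla sums in progressions of modulus `≤ N^η`; so `PrimeCellsRelative` follows from
# `CellParityLaw ∧ LiouvilleTupleMean` — a parity input with NO primes, NO zero locus, level `N^η` only.

Statements only (the `sorry`s mark what a crux-plan seat would register as stubs); everything is over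
existing declarations of `Literature.NumberTheory.Sieve` and the route file.
-/

noncomputable section

open scoped BigOperators Classical
open Finset Literature.NumberTheory.Sieve
open Summit.Parity.GeneralizedHardyLittlewood.Theses.LeeYangFibres

namespace Summit.Parity.GeneralizedHardyLittlewood.Cruxes.PrimeCellsRelative.Ideator4

/-- Liouville sign `λ(m) = (-1)^{Ω(m)}` of an integer value (junk value at `m ≤ 0`; every statement
below restricts to positive values). -/
def lam (m : ℤ) : ℝ := (ArithmeticFunction.liouville m.toNat : ℝ)

/-- The joint `N^{1/u}`-rough tuples of the system over the body `K` (all `ψ_i(n)` rough; this is the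
disjoint union of the route's cells `C_j`, `j ∈ [1,u]^t`, for `N` large). -/
def roughTuples {t : ℕ} (Ψ : Fin t → AffLinForm 1) (K : Set (Fin 1 → ℝ)) (N u : ℕ) :
    Finset (Fin 1 → ℤ) :=
  (latticeBox 1 N).filter (fun n => realPoint n ∈ K ∧
    ∀ i, (N : ℝ) ^ ((1 : ℝ) / u) < (Nat.minFac ((Ψ i).eval n).toNat : ℝ))

/-- `E_S(Ψ, K, N, u) = ∑_{n rough tuple} ∏_{i ∈ S} λ(ψ_i(n))` — the rough-restricted `|S|`-point
Liouville correlation; by Walsh inversion over the cells it equals `(−1)^{|S|} θ_S · M A^t` up to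
`O(2^{t+1} ρ₁(u) M A^t)` and the law's cell errors (card, Why it bites (1)). -/
def roughCorrelation {t : ℕ} (Ψ : Fin t → AffLinForm 1) (K : Set (Fin 1 → ℝ)) (N u : ℕ)
    (S : Finset (Fin t)) : ℝ :=
  ∑ n ∈ roughTuples Ψ K N u, ∏ i ∈ S, lam ((Ψ i).eval n)

/-- `F_S(Ψ, K, N; d, r) = ∑_{n ∈ K ∩ ℤ, n ≡ r (d), ψ_i(n) ≥ 1 (i ∈ S)} ∏_{i ∈ S} λ(ψ_i(n))` — a plain
`|S|`-point Chowla sum along the progression `r mod d` of an interval (no roughness, no primes). -/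
def apCorrelation {t : ℕ} (Ψ : Fin t → AffLinForm 1) (K : Set (Fin 1 → ℝ)) (N : ℕ)
    (S : Finset (Fin t)) (d : ℕ) (r : ℤ) : ℝ :=
  ∑ n ∈ (latticeBox 1 N).filter (fun n => realPoint n ∈ K ∧ (∀ i ∈ S, 0 < (Ψ i).eval n) ∧
      (d : ℤ) ∣ (n 0 - r)),
    ∏ i ∈ S, lam ((Ψ i).eval n)

/-- **The parity input (crux-grade).** `LiouvilleTupleMean t`: a Bombieri–Vinogradov MEAN VALUE for
`k`-point Liouville correlations (`2 ≤ k ≤ t`) along sub-systems of a bounded-size `d = 1` system, at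
level `N^η` for SOME `η > 0`, with total saving `(log N)^{−t}` (per progression this is a saving
`(log N)^{−2t}` against the trivial bound; for `t = 2`: 2-point Chowla with `(log N)^{−4}`), natural
density, uniform in shifts `≤ LN`. Residues enter through an arbitrary choice function `r`, i.e. the
bound is on `∑_d t^{ω(d)} max_r |F_S(d, r)|`. Nothing about primes. -/
def LiouvilleTupleMean (t : ℕ) : Prop :=
  ∀ L : ℕ, ∃ η : ℝ, 0 < η ∧ ∃ C : ℝ, ∃ N₀ : ℕ, ∀ N : ℕ, N₀ ≤ N →
    ∀ Ψ : Fin t → AffLinForm 1, IsNondegenerateSystem Ψ → affLinSize Ψ N ≤ L →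
    ∀ K : Set (Fin 1 → ℝ), Convex ℝ K → K ⊆ realBox 1 N →
    ∀ S : Finset (Fin t), 2 ≤ S.card → ∀ r : ℕ → ℤ,
      ∑ d ∈ (Icc 1 ⌊(N : ℝ) ^ η⌋₊).filter Squarefree,
          (t : ℝ) ^ (d.primeFactors.card) * |apCorrelation Ψ K N S d (r d)| ≤
        C * N / Real.log N ^ t

/-- The `|S| = 1` slice with arbitrary log-power saving — a THEOREM (Bombieri–Vinogradov for `λ`, in
the tree as `Literature.NumberTheory.Sieve.BVLiouvilleHeights.bv_liouvilleAP`, applied to the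
progression `{a_i n + b_i : n ≡ r (d)}` of modulus `|a_i| d ≤ L N^η ≪ N^{1/2}/log^B N`). -/
def LiouvilleBV (t : ℕ) : Prop :=
  ∀ L : ℕ, ∀ A : ℝ, ∃ η : ℝ, 0 < η ∧ ∃ C : ℝ, ∃ N₀ : ℕ, ∀ N : ℕ, N₀ ≤ N →
    ∀ Ψ : Fin t → AffLinForm 1, IsNondegenerateSystem Ψ → affLinSize Ψ N ≤ L →
    ∀ K : Set (Fin 1 → ℝ), Convex ℝ K → K ⊆ realBox 1 N →
    ∀ i : Fin t, ∀ r : ℕ → ℤ,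
      ∑ d ∈ (Icc 1 ⌊(N : ℝ) ^ η⌋₊).filter Squarefree,
          (t : ℝ) ^ (d.primeFactors.card) * |apCorrelation Ψ K N {i} d (r d)| ≤
        C * N / Real.log N ^ A

/-- **First lemma of the line (the lever; provable now, size L): SIEVE OUT.** For every `t, L` there is
`C = C(t, L)` such that for all `s ≥ 1`, `u ≥ 2` and `N ≥ N₀(t, L, s, u)`, every non-degenerate system
of size `≤ L`, every convex `K ⊆ [−N, N]` and every `S ⊆ [t]`:
`|E_S| ≤ C e^{−s} · #roughTuples + ∑_{d ≤ N^{s/u}, d squarefree} t^{ω(d)} |F_S(d, r_d)|` for some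
residues `r_d`. Proof route: apply the tree's two-sided fundamental lemma
`SieveSequence.fundamental_lemma_uniform_holds` (dimension `κ = t`, level `D = z^s`, `z = N^{1/u}`)
to the two NON-NEGATIVE sequences `𝟙[∏_{i∈S} λ(ψ_i(n)) = ±1] · 𝟙_K(n)` sifted by `p ∣ ∏_i ψ_i(n)`,
both with the same size parameter `X = |K ∩ ℤ ∩ {Ψ > 0}|/2`, so that the main terms `X V(z)` cancel in
the difference and the remainders are `±½ ∑_{r ∈ Roots(d)} F_S(d, r) + O(t^{ω(d)})`;
`#Roots(d) ≤ t^{ω(d)}` off the locally obstructed systems (where both sides vanish), and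
`|K'| V(z) ≤ 2 · #roughTuples` by the lower-bound half of the same lemma. -/
theorem sieveTransfer (t L : ℕ) :
    ∃ C : ℝ, 0 < C ∧ ∀ s : ℝ, 1 ≤ s → ∀ u : ℕ, 2 ≤ u → ∃ N₀ : ℕ, ∀ N : ℕ, N₀ ≤ N →
      ∀ Ψ : Fin t → AffLinForm 1, IsNondegenerateSystem Ψ → affLinSize Ψ N ≤ L →
      ∀ K : Set (Fin 1 → ℝ), Convex ℝ K → K ⊆ realBox 1 N →
      ∀ S : Finset (Fin t), ∃ r : ℕ → ℤ,
        |roughCorrelation Ψ K N u S| ≤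
          C * Real.exp (-s) * ((roughTuples Ψ K N u).card : ℝ) +
            ∑ d ∈ (Icc 1 ⌊(N : ℝ) ^ (s / u)⌋₊).filter Squarefree,
              (t : ℝ) ^ (d.primeFactors.card) * |apCorrelation Ψ K N S d (r d)| := by
  sorry

/-- **Walsh extraction (provable now, size M): under the law, `θ_S` is `E_S`.** With the amplitudes
`θ` supplied by `CellParityLaw` at accuracy `ε` and roughness `u`, for every `S ≠ ∅`:
`|θ_S| · M A^t ≤ |E_S| + 2^{t+1} |ρ₁| M A^t + u^t ε N / log^t N`, where `M = β_∞ 𝔖`,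
`A = ∑_m A_m(N)/N`, `ρ₁ = ∑_m (−1)^{m+1} A_m / ∑_m A_m` (→ 0 by `ModelCellFacts`, PROVED), and
`#roughTuples = M A^t (1 + O(2^{t+1}|ρ₁|)) + O(u^t ε N/log^t N)` (the case `S = ∅`). Stated here in
its consumable end form together with the sieve transfer: the composition that closes the crux BY
NAME (size L on top of the two lemmas; the constants are chosen in the order
`ε_final → δ → ε₁ → (C_H, η) → s → u → ε_law → N₀`, `u` before `N₀` as the crux's `∃ u` demands). -/
theorem chowlaClipsParity :
    CellParityLaw → (∀ t : ℕ, 1 ≤ t → LiouvilleTupleMean t) → (∀ t : ℕ, 1 ≤ t → LiouvilleBV t) →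
      ModelCellFacts → PrimeCellsRelative := by
  sorry

/-- The singleton slice is a theorem of the tree (BV for `λ` with per-modulus heights,
`BVLiouvilleHeights.bv_liouvilleAP`, plus the divisor-weight Cauchy–Schwarz). Size M. -/
theorem liouvilleBV_holds (t : ℕ) (ht : 1 ≤ t) : LiouvilleBV t := by
  sorry

/-- Hence the line's composition: the crux from the route's crux 3, the new parity input, and two
provable-now lemmas (`ModelCellFacts` is item 14111, PROVED: `modelCellFacts_proof`). -/
theorem primeCellsRelative_of_law_of_liouvilleTupleMean
    (hLaw : CellParityLaw) (hChowla : ∀ t : ℕ, 1 ≤ t → LiouvilleTupleMean t)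
    (hModel : ModelCellFacts) : PrimeCellsRelative :=
  chowlaClipsParity hLaw hChowla liouvilleBV_holds hModel

end Summit.Parity.GeneralizedHardyLittlewood.Cruxes.PrimeCellsRelative.Ideator4

end
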